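/-
Copyright: see repository. [cite: CossartPiltant2008, Proposition 9.3, proof, (46)–(52) (HAL pp. 27–28)]
-/
import Literature.AlgebraicGeometry.CossartPiltant200819.MonomialInversion2008

/-!
# [CP-I] Proposition 9.3 (journal Prop. 9.1), proof, equations (46)–(52): the monomial and
  radical bookkeeping of the case `K′ = K^s`, PROVED as pure algebra

[CP-I] V. Cossart, O. Piltant, *Resolution of singularities of threefolds in positive
characteristic. I.*, J. Algebra **320** (2008) 1051–1082, HAL hal-00139124, proof of Prop. 9.3,
running head p. 27 l. 35 – p. 28 l. 88 (the case `K′ = K^s`).  VERBATIM (HAL p. 27): "Let `R₁`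
be a normal local model of `V/k` such that `R₁′` dominates the given local uniformization `S₀′` of
`V′/k`. We now pick `f_1, …, f_r ∈ R₁` such that `(V f_1, …, V f_r)` form a basis of `V_K ⊗_ℤ ℚ`,
and let `f₀ := f_1 ⋯ f_r`. By proposition 8.1, there exists `f ∈ m_{R₁′}`, `f ≠ 0` such that
`f₀ | f` and a local uniformization `S′` of `V′/k` with r.s.p. `(x_1, x_2, x_3)` having the
following properties; (1) `R₁′ < S′` and `(R₁′)_f = S′_f`. (2) `√(f S′) = m_{R₁′} S′ = (x_1 ⋯ x_r)`,
and `V′x_1, …, V′x_r` are linearly independent in `V′_{K′} ⊗_ℤ ℚ`.  For each `i`, `1 ≤ i ≤ r`,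
there is an expression `f_i = γ_i ∏_{j=1}^r x_j^{a_ij}`, where `γ_i` is a unit in `S′`. Since
`(V f_i)` and `(V′ x_j)` are bases of `V′_{K′} ⊗_ℤ ℚ`, the matrix `A := (a_ij)` is nonsingular.
After possibly permuting two of the `f_i`'s (if `r ≥ 2`), it can be assumed that `det A > 0`.
Let `B =: (b_ij)` be the adjoint matrix of `A`, and let
(46) `F_i := ∏_{j=1}^r f_j^{b_ji} = (∏_{j=1}^r γ_j^{b_ji}) x_i^{det A} ∈ S′ ∩ K`, for `1 ≤ i ≤ r`."
(HAL p. 28): "If `r ≤ 2`, let `P′ := (x_{r+1}, …, x_3) ∈ Spec S′` … there exists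
`g_{r+1}, …, g_3 ∈ P₁′` such that (47) `P′ = (g′_{r+1}, …, g′_3)`, where (48)
`g_j =: g′_j ∏_{i=1}^r x_i^{c_ij}`, with `g′_j ∈ S′` not divisible by `x_i` … We let
(49) `G′_j := g_j^{det A} / ∏_{i=1}^r F_i^{c_ij} = γ′_j (g′_j)^{det A} ∈ S′`, where `γ′_j ∈ S′` is
a unit … `R₁` lies dense in `R₁′` for the `m_{R₁′}`-adic topology. Let (50) `C := max_{i,j} {c_ij}`
and let `h_j ∈ R₁` be such that `h_j ≡ g_j mod m_{R₁′}^{C+1}` … there is an expression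
`h_j =: h′_j ∏_{i=1}^r x_i^{c_ij}`, with `h′_j ∈ S′` …, and a congruence
`h′_j ≡ g′_j mod (x_1 ⋯ x_r) S′`.  Let `H_j := h_j^{det A} / ∏_{i=1}^r F_i^{c_ij} ∈ S′ ∩ K`.
Comparison with (49) produces the congruence (51) `H_j ≡ γ′_j (g′_j)^{det A} mod (x_1 ⋯ x_r) S′`,
for `r + 1 ≤ j ≤ 3`. By (46), (47) and (51), we have (52) `√(({F_i}_{1≤i≤r}, {H_j}_{r+1≤j≤3}) S′)
= m_{S′}`."

This file PROVES the algebra of (46), (49), (51) and (52) for an arbitrary finite set of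
monomial parameters `x_ι` and of residual parameters (no dimension hypothesis), leaving to the
DAG of Prop. 9.3 exactly its non-algebraic inputs: Prop. 8.1 (`MonomialUniformization`), the
birational statement (47)–(48), the `m_{R₁′}`-adic density of `R₁` in `R₁′ ⊂ R₁^h` ([40] Thm. 2
p. 110) giving the `h_j`, Zariski's Main Theorem ([40] Thm. 1 p. 41) and the local-étale descent
of regularity (45).
* `exists_uniform_dagger` — (46) with ONE exponent `D = |det A| ≥ 1` for all `i`: units `Γ_i` of
  `S′` with `F_i := Γ_i x_i^D ∈ S′ ∩ K` (the adjugate device of `MonomialInversion2008`, which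
  recorded the per-index form for [Fu1997] / Lemma 9.4);
* `pow_div_prod_pow_eq` — (49) (and `H_j`): `g^D / ∏_i F_i^{c_i} = (∏_i Γ_i^{c_i})⁻¹ · (g′)^D`
  when `g = g′ ∏_i x_i^{c_i}` and `F_i = Γ_i x_i^D`;
* `mul_pow_sub_mul_pow_mem` — (51): `h′ ≡ g′ mod I ⇒ γ′ h′^D ≡ γ′ g′^D mod I`;
* `radical_span_eq_of_monomials` — (52): in a commutative ring with a maximal ideal
  `m = (x_ι, y_κ)` (`ι` nonempty), if `F_i = Γ_i x_i^D` (`Γ_i` units, `D ≥ 1`) and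
  `H_j ≡ γ′_j y_j^D mod (∏_i x_i)` (`γ′_j` units), then `√((F_ι, H_κ)) = m`.
-/

namespace Literature.AlgebraicGeometry.CossartPiltant200819.CP2008

open Literature.AlgebraicGeometry.CossartPiltant200819.MonomialInversion

/-! ## (46) — the `F_i`, with one exponent for all `i` -/

section Dagger

variable {k K L : Type*} [Field k] [Field K] [Field L] [Algebra K L] [Algebra k L]
variable {ι : Type*} [Fintype ι] [DecidableEq ι]

/-- **(46), uniform form** (HAL p. 27 l. 45 – p. 28 l. 3): let `S′` be a `k`-subalgebra of `L`
(= `K′`), `x_1, …, x_r ∈ S′` nonzero, `γ_i` units of `S′`, `f_i ∈ K` with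
`f_i = γ_i ∏_l x_l^{a_il}` in `L` and `det (a_il) ≠ 0`.  Then with `D := |det A| ≥ 1` there are
units `Γ_i` of `S′` (`Γ_i = (∏_j γ_j^{adj(A)_ij})^{±1}`, with inverse in `S′`) such that every
`F_i := Γ_i x_i^D` lies in
`K` (and in `S′`): "`F_i := ∏_j f_j^{b_ji} = (∏_j γ_j^{b_ji}) x_i^{det A} ∈ S′ ∩ K`" — the
sign `±` replaces the printed "after possibly permuting two of the `f_i`'s … `det A > 0`".
[cite: CossartPiltant2008, Proposition 9.3, proof, (46) (HAL pp. 27–28)] -/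
theorem exists_uniform_dagger (S : Subalgebra k L) (x : ι → L) (hx : ∀ l, x l ≠ 0)
    (γ : ι → L) (hγS : ∀ i, γ i ∈ S) (hγu : ∀ i, ∃ γ' ∈ S, γ i * γ' = 1)
    (f : ι → K) (A : Matrix ι ι ℕ)
    (hrel : ∀ i, algebraMap K L (f i) = γ i * ∏ l, x l ^ A i l)
    (hdet : (A.map (Nat.cast : ℕ → ℤ)).det ≠ 0) :
    ∃ D : ℕ, 0 < D ∧ ∃ Γ : ι → L, (∀ i, Γ i ∈ S) ∧ (∀ i, ∃ Γ' ∈ S, Γ i * Γ' = 1) ∧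
      ∀ i, Γ i * x i ^ D ∈ Set.range (algebraMap K L) := by
  set Az : Matrix ι ι ℤ := A.map (Nat.cast : ℕ → ℤ) with hAz
  set B : Matrix ι ι ℤ := Az.adjugate with hB
  set d : ℤ := Az.det with hd
  set u : ι → L := fun i => ∏ j, γ j ^ B i j with hu
  have hγ0 : ∀ i, γ i ≠ 0 := fun i h => by
    obtain ⟨γ', -, h1⟩ := hγu i
    rw [h, zero_mul] at h1
    exact zero_ne_one h1
  have hγinv : ∀ i, (γ i)⁻¹ ∈ S := fun i => by
    obtain ⟨γ', hγ', h1⟩ := hγu i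
    rw [inv_eq_of_mul_eq_one_right h1]
    exact hγ'
  have huS : ∀ i, u i ∈ S := fun i =>
    prod_mem fun j _ => zpow_mem_of_inv_mem (hγS j) (hγinv j) _
  have hu'S : ∀ i, (u i)⁻¹ ∈ S := fun i => by
    rw [hu]
    dsimp only
    rw [← Finset.prod_inv_distrib]
    exact prod_mem fun j _ => by
      rw [← _root_.zpow_neg]; exact zpow_mem_of_inv_mem (hγS j) (hγinv j) _
  have hu0 : ∀ i, u i ≠ 0 := fun i =>
    Finset.prod_ne_zero_iff.mpr fun j _ => zpow_ne_zero _ (hγ0 j)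
  -- the identity (46), pushed through `K → L`
  have hid : ∀ i, algebraMap K L (∏ j, f j ^ B i j) = u i * x i ^ d := fun i => by
    rw [map_prod]
    simp_rw [map_zpow₀]
    exact prod_zpow_adjugate_eq x γ (fun j => algebraMap K L (f j)) hx A hrel i
  rcases lt_or_gt_of_ne hdet with hneg | hpos
  · -- `det A < 0`: invert
    refine ⟨(-d).toNat, by omega, fun i => (u i)⁻¹, hu'S,
      fun i => ⟨u i, huS i, inv_mul_cancel₀ (hu0 i)⟩, fun i => ⟨(∏ j, f j ^ B i j)⁻¹, ?_⟩⟩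
    rw [map_inv₀, hid i]
    have hD : (((-d).toNat : ℕ) : ℤ) = -d := Int.toNat_of_nonneg (by omega)
    rw [← zpow_natCast, hD, mul_inv, _root_.zpow_neg]
  · -- `det A > 0`
    refine ⟨d.toNat, by omega, u, huS, fun i => ⟨(u i)⁻¹, hu'S i, mul_inv_cancel₀ (hu0 i)⟩,
      fun i => ⟨∏ j, f j ^ B i j, ?_⟩⟩
    rw [hid i]
    have hD : ((d.toNat : ℕ) : ℤ) = d := Int.toNat_of_nonneg hpos.le
    rw [← zpow_natCast, hD]

end Dagger

/-! ## (49) and (51) — the `G′_j`, `H_j` -/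

section Quotients

/-- **(49)** (HAL p. 28 l. 30–40), the computation: if `g = g′ ∏_i x_i^{c_i}` and
`F_i = Γ_i x_i^D` with all `x_i ≠ 0`, then
`g^D / ∏_i F_i^{c_i} = (∏_i Γ_i^{c_i})⁻¹ (g′)^D` ("`G′_j := g_j^{det A} / ∏ F_i^{c_ij} =
γ′_j (g′_j)^{det A}`", with the unit `γ′_j = (∏_i Γ_i^{c_ij})⁻¹`; the same computation gives
`H_j = γ′_j (h′_j)^{det A}`).
[cite: CossartPiltant2008, Proposition 9.3, proof, (49) (HAL p. 28)] -/
theorem pow_div_prod_pow_eq {L : Type*} [Field L] {ι : Type*} [Fintype ι] (x Γ : ι → L)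
    (hx : ∀ i, x i ≠ 0) (D : ℕ) (c : ι → ℕ) {g g' : L}
    (hg : g = g' * ∏ i, x i ^ c i) :
    g ^ D / ∏ i, (Γ i * x i ^ D) ^ c i = (∏ i, Γ i ^ c i)⁻¹ * g' ^ D := by
  have hden : ∏ i, (Γ i * x i ^ D) ^ c i = (∏ i, Γ i ^ c i) * (∏ i, x i ^ c i) ^ D := by
    rw [← Finset.prod_pow, ← Finset.prod_mul_distrib]
    refine Finset.prod_congr rfl fun i _ => ?_
    rw [mul_pow, ← pow_mul, ← pow_mul, mul_comm D]
  have hP : (∏ i, x i ^ c i) ^ D ≠ 0 :=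
    pow_ne_zero _ (Finset.prod_ne_zero_iff.mpr fun i _ => pow_ne_zero _ (hx i))
  rw [hden, hg, mul_pow, mul_div_mul_right _ _ hP, div_eq_mul_inv, mul_comm]

/-- **(51)** (HAL p. 28 l. 63–76), the computation: a congruence `h′ ≡ g′ mod I` gives
`γ′ h′^D ≡ γ′ g′^D mod I` ("Comparison with (49) produces the congruence
`H_j ≡ γ′_j (g′_j)^{det A} mod (x_1 ⋯ x_r) S′`", from `h′_j ≡ g′_j mod (x_1 ⋯ x_r) S′`).
[cite: CossartPiltant2008, Proposition 9.3, proof, (51) (HAL p. 28)] -/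
theorem mul_pow_sub_mul_pow_mem {S : Type*} [CommRing S] (I : Ideal S) {h' g' : S}
    (hhg : h' - g' ∈ I) (u : S) (D : ℕ) : u * h' ^ D - u * g' ^ D ∈ I := by
  obtain ⟨c, hc⟩ := sub_dvd_pow_sub_pow h' g' D
  rw [← mul_sub, hc, ← mul_assoc, mul_comm (u * _) c, ← mul_assoc]
  exact I.mul_mem_left _ hhg

end Quotients

/-! ## (52) — the radical -/

section Radical

variable {S : Type*} [CommRing S] {ι κ : Type*} [Fintype ι]

/-- In a commutative ring, a product over a nonempty finite family one of whose members lies in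
the ideal `J` lies in `J`. [folklore] -/
private theorem prod_mem_of_mem (J : Ideal S) (x : ι → S) {i₀ : ι} (h : x i₀ ∈ J) :
    ∏ i, x i ∈ J := by
  classical
  rw [← Finset.mul_prod_erase Finset.univ x (Finset.mem_univ i₀)]
  exact J.mul_mem_right _ h

/-- **(52)** (HAL p. 28 l. 76–82): "By (46), (47) and (51), we have
`√(({F_i}_{1≤i≤r}, {H_j}_{r+1≤j≤3}) S′) = m_{S′}`."  Abstract form: in a commutative ring `S′`
with a maximal ideal `m = (x_ι, y_κ)` ((47): `m_{S′} = (x_1, …, x_r) + P′`,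
`P′ = (g′_{r+1}, …, g′_3)`), `ι` nonempty (`r ≥ 1`), if `F_i = Γ_i x_i^D` with `Γ_i` units and
`D ≥ 1` ((46)) and `H_j ≡ γ′_j y_j^D mod (∏_i x_i)` with `γ′_j` units ((51)), then the radical of
`(F_ι, H_κ)` is `m`.  Any finite `ι`, any `κ`: no dimension hypothesis.
[cite: CossartPiltant2008, Proposition 9.3, proof, (52) (HAL p. 28)] -/
theorem radical_span_eq_of_monomials [Nonempty ι] {m : Ideal S} (hm : m.IsMaximal)
    (x : ι → S) (y : κ → S) (hmxy : m = Ideal.span (Set.range x ∪ Set.range y))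
    {D : ℕ} (hD : 0 < D) (Γ : ι → S) (hΓ : ∀ i, IsUnit (Γ i)) (F : ι → S)
    (hF : ∀ i, F i = Γ i * x i ^ D) (γ' : κ → S) (hγ' : ∀ j, IsUnit (γ' j)) (H : κ → S)
    (hH : ∀ j, H j - γ' j * y j ^ D ∈ Ideal.span {∏ i, x i}) :
    (Ideal.span (Set.range F ∪ Set.range H)).radical = m := by
  classical
  obtain ⟨i₀⟩ := ‹Nonempty ι›
  have hxm : ∀ i, x i ∈ m := fun i => hmxy ▸ Ideal.subset_span (Or.inl ⟨i, rfl⟩)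
  have hym : ∀ j, y j ∈ m := fun j => hmxy ▸ Ideal.subset_span (Or.inr ⟨j, rfl⟩)
  have hprodm : ∏ i, x i ∈ m := prod_mem_of_mem m x (hxm i₀)
  apply le_antisymm
  · -- `(F, H) ⊆ m`, and `m` is radical
    rw [hm.isPrime.radical_le_iff, Ideal.span_le]
    rintro _ (⟨i, rfl⟩ | ⟨j, rfl⟩)
    · rw [SetLike.mem_coe, hF i]
      exact m.mul_mem_left _ (m.pow_mem_of_mem (hxm i) D hD)
    · rw [SetLike.mem_coe]
      have h1 : H j - γ' j * y j ^ D ∈ m :=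
        (Ideal.span_singleton_le_iff_mem _|>.mpr hprodm) (hH j)
      have h2 : γ' j * y j ^ D ∈ m := m.mul_mem_left _ (m.pow_mem_of_mem (hym j) D hD)
      simpa using m.add_mem h1 h2
  · -- `m ⊆ √(F, H)`: each `x_i` and each `y_j` has a power in `(F, H)`
    have hxr : ∀ i, x i ∈ (Ideal.span (Set.range F ∪ Set.range H)).radical := fun i => by
      obtain ⟨v, hv⟩ := (hΓ i).exists_left_inv
      refine ⟨D, ?_⟩
      have : x i ^ D = v * F i := by rw [hF i, ← mul_assoc, hv, one_mul]
      rw [this]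
      exact Ideal.mul_mem_left _ _ (Ideal.subset_span (Or.inl ⟨i, rfl⟩))
    have hprodr : ∏ i, x i ∈ (Ideal.span (Set.range F ∪ Set.range H)).radical :=
      prod_mem_of_mem _ x (hxr i₀)
    have hyr : ∀ j, y j ∈ (Ideal.span (Set.range F ∪ Set.range H)).radical := fun j => by
      obtain ⟨v, hv⟩ := (hγ' j).exists_left_inv
      rw [← Ideal.radical_idem]
      refine ⟨D, ?_⟩
      have h1 : H j - γ' j * y j ^ D ∈ (Ideal.span (Set.range F ∪ Set.range H)).radical :=
        (Ideal.span_singleton_le_iff_mem _|>.mpr hprodr) (hH j)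
      have h2 : H j ∈ (Ideal.span (Set.range F ∪ Set.range H)).radical :=
        Ideal.le_radical (Ideal.subset_span (Or.inr ⟨j, rfl⟩))
      have h3 : γ' j * y j ^ D ∈ (Ideal.span (Set.range F ∪ Set.range H)).radical := by
        simpa using Ideal.sub_mem _ h2 h1
      have : y j ^ D = v * (γ' j * y j ^ D) := by rw [← mul_assoc, hv, one_mul]
      rw [this]
      exact Ideal.mul_mem_left _ _ h3
    rw [hmxy, Ideal.span_le]
    rintro _ (⟨i, rfl⟩ | ⟨j, rfl⟩)
    · exact hxr i
    · exact hyr j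

end Radical

/-! ## (46)–(52) assembled in the printed setting `S′ ⊆ K′`, `K ⊆ K′` -/

section Assembled

variable {k K L : Type*} [Field k] [Field K] [Field L] [Algebra K L] [Algebra k L]
variable {ι κ : Type*} [Fintype ι] [DecidableEq ι]

/-- **[CP-I] Prop. 9.3, proof, (46)–(52) assembled** (HAL p. 27 l. 45 – p. 28 l. 82).  Printed
data: `S′` a `k`-subalgebra of `K′ = L` with maximal ideal `m_{S′} = (x_1, …, x_r, g′_{r+1}, …,
g′_3)` ((47): `P′ = (x_{r+1}, …, x_3) = (g′_{r+1}, …, g′_3)`), `x_i ≠ 0`, `r ≥ 1`;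
`f_i ∈ K` with `f_i = γ_i ∏_l x_l^{a_il}`, `γ_i` units of `S′`, `det (a_il) ≠ 0` (Prop. 8.1 and
HAL p. 27 l. 45–61); `h_j ∈ K` (the `m_{R₁′}`-adic approximants of the `g_j`, HAL p. 28 l. 49)
with `h_j = h′_j ∏_i x_i^{c_ij}`, `h′_j ∈ S′`, and `h′_j ≡ g′_j mod (x_1 ⋯ x_r) S′` (l. 51–64).
Conclusion: there are `D ≥ 1`, `F_i ∈ S′ ∩ K` (`1 ≤ i ≤ r`) and `H_j ∈ S′ ∩ K` (`r + 1 ≤ j ≤ 3`)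
with (52) `√((F_i, H_j) S′) = m_{S′}` — namely `F_i = Γ_i x_i^D` ((46), `exists_uniform_dagger`)
and `H_j = h_j^D / ∏_i F_i^{c_ij} = γ′_j (h′_j)^D` ((49), `pow_div_prod_pow_eq`), with (51)
`H_j ≡ γ′_j (g′_j)^D` (`mul_pow_sub_mul_pow_mem`) and (52) (`radical_span_eq_of_monomials`).
Any finite nonempty `ι`, any `κ`: no dimension hypothesis.
[cite: CossartPiltant2008, Proposition 9.3, proof, (46)–(52) (HAL pp. 27–28)] -/
theorem prop93_exists_radical_eq [Nonempty ι] (S : Subalgebra k L) {m : Ideal S}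
    (hm : m.IsMaximal) (x : ι → S) (hx0 : ∀ i, (x i : L) ≠ 0) (g' : κ → S)
    (hmxg : m = Ideal.span (Set.range x ∪ Set.range g'))
    (γ : ι → S) (hγu : ∀ i, IsUnit (γ i)) (f : ι → K) (A : Matrix ι ι ℕ)
    (hrel : ∀ i, algebraMap K L (f i) = (γ i : L) * ∏ l, (x l : L) ^ A i l)
    (hdet : (A.map (Nat.cast : ℕ → ℤ)).det ≠ 0)
    (c : κ → ι → ℕ) (h : κ → K) (h' : κ → S)
    (hh : ∀ j, algebraMap K L (h j) = (h' j : L) * ∏ i, (x i : L) ^ c j i)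
    (hcong : ∀ j, h' j - g' j ∈ Ideal.span {∏ i, x i}) :
    ∃ D : ℕ, 0 < D ∧ ∃ (F : ι → S) (H : κ → S),
      (∀ i, (F i : L) ∈ Set.range (algebraMap K L)) ∧
      (∀ j, (H j : L) ∈ Set.range (algebraMap K L)) ∧
      (∀ j, (H j : L) = algebraMap K L (h j) ^ D / ∏ i, (F i : L) ^ c j i) ∧
      (Ideal.span (Set.range F ∪ Set.range H)).radical = m := by
  classical
  -- (46): the `F_i`
  have hγS : ∀ i, (γ i : L) ∈ S := fun i => (γ i).2
  have hγu' : ∀ i, ∃ γ' ∈ S, (γ i : L) * γ' = 1 := fun i => by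
    obtain ⟨u, hu⟩ := hγu i
    refine ⟨((u⁻¹ : Sˣ) : S), Subtype.mem _, ?_⟩
    rw [← hu, ← Subalgebra.coe_mul, Units.mul_inv, Subalgebra.coe_one]
  obtain ⟨D, hD, Γ, hΓS, hΓu, hF⟩ :=
    exists_uniform_dagger S (fun i => (x i : L)) hx0 (fun i => (γ i : L)) hγS hγu' f A hrel hdet
  choose Γ' hΓ'S hΓΓ' using hΓu
  choose fK hfK using hF
  have hΓunit : ∀ i, IsUnit (⟨Γ i, hΓS i⟩ : S) := fun i =>
    isUnit_iff_exists_inv.mpr ⟨⟨Γ' i, hΓ'S i⟩, Subtype.ext (hΓΓ' i)⟩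
  have hΓ'unit : ∀ i, IsUnit (⟨Γ' i, hΓ'S i⟩ : S) := fun i =>
    isUnit_iff_exists_inv.mpr ⟨⟨Γ i, hΓS i⟩, Subtype.ext ((mul_comm _ _).trans (hΓΓ' i))⟩
  -- the elements `F_i := Γ_i x_i^D`, `γ′_j := ∏_i (Γ_i⁻¹)^{c_ij}`, `H_j := γ′_j (h′_j)^D`
  refine ⟨D, hD, fun i => ⟨Γ i, hΓS i⟩ * x i ^ D,
    fun j => (∏ i, (⟨Γ' i, hΓ'S i⟩ : S) ^ c j i) * h' j ^ D, fun i => ⟨fK i, ?_⟩, fun j => ?_,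
    fun j => ?_, ?_⟩
  · rw [hfK i]; push_cast; rfl
  · -- `H_j ∈ K`: `H_j = h_j^D / ∏ F_i^{c_ij}` with `h_j, F_i ∈ K`
    refine ⟨h j ^ D / ∏ i, fK i ^ c j i, ?_⟩
    rw [map_div₀, map_pow, map_prod]
    simp_rw [map_pow, hfK]
    rw [pow_div_prod_pow_eq (fun i => (x i : L)) Γ hx0 D (c j) (hh j)]
    push_cast
    congr 1
    rw [← Finset.prod_inv_distrib]
    refine Finset.prod_congr rfl fun i _ => ?_
    rw [← inv_pow, inv_eq_of_mul_eq_one_right (hΓΓ' i)]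
  · -- (49) for `H_j`
    push_cast
    rw [pow_div_prod_pow_eq (fun i => (x i : L)) Γ hx0 D (c j) (hh j)]
    congr 1
    rw [← Finset.prod_inv_distrib]
    refine Finset.prod_congr rfl fun i _ => ?_
    rw [← inv_pow, inv_eq_of_mul_eq_one_right (hΓΓ' i)]
  · -- (51) and (52)
    refine radical_span_eq_of_monomials hm x g' hmxg hD (fun i => ⟨Γ i, hΓS i⟩) hΓunit _
      (fun i => rfl) (fun j => ∏ i, (⟨Γ' i, hΓ'S i⟩ : S) ^ c j i)
      (fun j => IsUnit.prod_univ_iff.mpr fun i => (hΓ'unit i).pow _) _ fun j => ?_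
    exact mul_pow_sub_mul_pow_mem _ (hcong j) _ _

end Assembled

end Literature.AlgebraicGeometry.CossartPiltant200819.CP2008
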